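import Mathlib
import Literature.NumberTheory.Automorphic.ResGLnCohomology
import Literature.NumberTheory.Automorphic.ClozelCohomologicalTypeProofs
import Literature.NumberTheory.Automorphic.AutomorphicRepsGLSatakeProofs
import Literature.NumberTheory.Automorphic.ClozelAlgebraicity
import Literature.Barriers.Langlands.NonRegularWeightBarrier
import Literature.NumberTheory.DiophantineGeometry.GLHighestWeightFacts
import HarnessLib

/-!
# The realisation input `hE` from the cuspidal-eigenclass statement (stub `stub_resRealisation`
of line `Sketch`)

Crux `HeckeEigenvalueField` (stmt-Langlands-13632). The landed Literature composition
`Clozel1990_heckeEigenvalueField_of_resRealisation (hE) (hB)` takes as `hE` the realisation of a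
cuspidal REGULAR ALGEBRAIC `π` on `GL_n(𝔸_K)` (`n ≥ 1`) as a non-zero simultaneous
`T_{v,i}`-eigenclass (`v ∤ 𝔫`) in some
`H^q(S_{K_f(𝔫)}, Ẽ_λ) = ResGLnCohomology.levelCohomology ℂ n K 𝔫 λ q`, with the eigenvalues
`t_{v,i} = q_v^{i(n-i)/2} e_i(α_v)` of its Satake parameters. This file derives `hE` from the
general-`K` cuspidal-eigenclass statement (named fact A of the line, kept here verbatim as the
hypothesis `hA`): a cuspidal `π` whose infinity type has, at every embedding `τ`, the `a`-multiset
of the cohomological type of `λ_τ^∨` (`λ` dominant), with a `K(𝔫)`-fixed vector off `W'`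
(`𝔫 ≠ 0`), has such an eigenclass. The three steps are those of the `K = ℚ` port
`Clozel1990_heckeEigenvalueField.rat_of_cuspidalEigenclass_exists`:

1. Clozel's Lemme 3.14 embedding by embedding
   (`InfinityType.IsRegularAlgebraic.exists_isDominant_forall_map_a_eq_cohomological`): the
   `a`-multisets of a regular algebraic infinity type `T` of `π` are those of
   `cohomologicalInfinityType n K (wt τ) τ` for a family `wt = (wt_τ)_τ` of dominant weights; put
   `λ_τ := wt_τ^∨` (dominant by `Weight.IsDominant.dual`, and `λ_τ^∨ = wt_τ` by `Weight.dual_dual`);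
2. the level: `AutomorphicRepData.exists_principalCongruenceLevel_fixed` gives `𝔫 ≠ 0` and a
   `K(𝔫)`-fixed `φ ∈ W ∖ W'`;
3. feed `hA` and repackage.

[cite: Clozel1990, Lemme 3.14–3.15]
-/

set_option linter.dupNamespace false -- project-wide: Summit.Langlands.Langlands is the mandated namespace

noncomputable section

open scoped Classical
open NumberField IsDedekindDomain Literature.NumberTheory.Automorphic
  Literature.NumberTheory.DiophantineGeometry Literature.Barriers.Langlands ResGLnCohomology

namespace Summit.Langlands.Langlands.Theorems.HeckeEigenvalueField.Res

/-- **Stub 4** — the realisation input `hE` of `Clozel1990_heckeEigenvalueField_of_resRealisation` for a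
cuspidal REGULAR ALGEBRAIC `π`, GIVEN the cuspidal-eigenclass statement of stub A (verbatim as
hypothesis): Clozel's Lemme 3.14 embedding by embedding
(`InfinityType.IsRegularAlgebraic.exists_isDominant_forall_map_a_eq_cohomological`, dualised with
`Weight.IsDominant.dual` / `Weight.dual_dual`) supplies the dominant `λ = (λ_τ)_τ`, and
`AutomorphicRepData.exists_principalCongruenceLevel_fixed` the level `𝔫 ≠ 0`.
[cite: Clozel1990, Lemme 3.14–3.15] -/
theorem stub_resRealisation
    (hA : ∀ (n : ℕ) (K : Type) [Field K] [NumberField K] (hcpt : isCompact_glFiniteIntegralLevel n K)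
      (𝔫 : Ideal (𝓞 K)) (lam : (K →+* ℂ) → Fin n → ℤ), 1 ≤ n → 𝔫 ≠ 0 →
      (∀ τ, Weight.IsDominant (lam τ)) →
      ∀ π : CuspidalAutomorphicRepData n K hcpt,
        (∃ T : InfinityType K n, π.1.HasInfinityType T ∧
          ∀ τ : K →+* ℂ, (T τ).map ArchWeight.a =
            (cohomologicalInfinityType n K (Weight.dual (lam τ)) τ).map ArchWeight.a) →
        (∃ φ ∈ π.1.W, φ ∉ π.1.W' ∧
          ∀ u ∈ principalCongruenceLevel n K 𝔫, rightTranslation (AdelicGroupData.gl n K) u φ = φ) →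
        ∃ (q : ℕ) (x : levelCohomology ℂ n K 𝔫 lam q), x ≠ 0 ∧
          ∀ v : HeightOneSpectrum (𝓞 K), ¬ v.asIdeal ∣ 𝔫 → ∀ α : Multiset ℂ,
            π.1.HasSatakeParamAt v α → ∀ i ≤ n,
              heckeT ℂ n K 𝔫 lam q v i x = heckeEigenvalueOf n v α i • x) :
    ∀ (n : ℕ) (K : Type) [Field K] [NumberField K]
      (hcpt : isCompact_glFiniteIntegralLevel n K) (π : CuspidalAutomorphicRepData n K hcpt),
      1 ≤ n → π.1.IsRegularAlgebraic →
      ∃ (𝔫 : Ideal (𝓞 K)) (_ : 𝔫 ≠ 0) (lam : (K →+* ℂ) → Fin n → ℤ) (q : ℕ)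
        (x : levelCohomology ℂ n K 𝔫 lam q), x ≠ 0 ∧
        ∀ v : HeightOneSpectrum (𝓞 K), ¬ v.asIdeal ∣ 𝔫 → ∀ α : Multiset ℂ,
          π.1.HasSatakeParamAt v α → ∀ i ≤ n,
            heckeT ℂ n K 𝔫 lam q v i x = heckeEigenvalueOf n v α i • x := by
  intro n K _ _ hcpt π hn hπ
  -- (1) Lemme 3.14 per embedding: dominant `wt τ` with the `a`-multisets of `T`
  obtain ⟨T, hT, hreg⟩ := hπ
  obtain ⟨wt, hdom, ha⟩ :=
    InfinityType.IsRegularAlgebraic.exists_isDominant_forall_map_a_eq_cohomological hT.1.1 hreg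
  -- `λ_τ := (wt τ)^∨`, dominant, with `λ_τ^∨ = wt τ`
  have hdom' : ∀ τ : K →+* ℂ, Weight.IsDominant (Weight.dual (wt τ)) := fun τ => (hdom τ).dual
  have ha' : ∀ τ : K →+* ℂ, (T τ).map ArchWeight.a =
      (cohomologicalInfinityType n K (Weight.dual (Weight.dual (wt τ))) τ).map ArchWeight.a :=
    fun τ => by rw [Weight.dual_dual]; exact ha τ
  -- (2) the level `𝔫 ≠ 0` with a `K(𝔫)`-fixed vector off `W'`
  obtain ⟨𝔫, h𝔫, φ, hφW, hφW', hfix⟩ := π.1.exists_principalCongruenceLevel_fixed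
  -- (3) the cuspidal eigenclass
  obtain ⟨q, x, hx, heig⟩ := hA n K hcpt 𝔫 (fun τ => Weight.dual (wt τ)) hn h𝔫 hdom' π
    ⟨T, hT, ha'⟩ ⟨φ, hφW, hφW', hfix⟩
  exact ⟨𝔫, h𝔫, fun τ => Weight.dual (wt τ), q, x, hx, heig⟩

end Summit.Langlands.Langlands.Theorems.HeckeEigenvalueField.Res

end
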